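import Literature.Computability.Complexity.PaulPippengerSzemerediTrotter1983Accepts
import HarnessLib

/-!
# Completeness of the `Σ₄` protocol: the honest strings pass (PPST 1983, §3)

Literature / complexity toolkit, nineteenth brick of the inline formalization of
Paul–Pippenger–Szemerédi–Trotter 1983 (`PaulPippengerSzemerediTrotter1983.lean`, fact
`PaulEtAl1983_NTIME_not_subset_DTIME`; roadmap Layer 4, assembly, part 4). The HONEST data of
the protocol for the packaged flat program on input `x` — the true light records of all blocks
`0 … N` with the true arithmetic witnesses, a set `J` and the true heavy data on `J` only
(`trueY1`), and for branch `j` the branch set of `j` with its true heavy data (`trueE`) — pass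
the verifier for every `y₂`, `y₄` (`accepts_true`), whence the COMPLETENESS half of the protocol
modulo the two size bounds (`complete_of_sizes`): `protocol_complete` of `…Protocol.lean`
transferred along the congruence lemmas of `…Accepts.lean` (the honest global claims carry no
heavy data outside `J`, which the closure of branch sets makes invisible), `allChecks_iff`, the
round trips of `…Formats.lean`.

* `PPSTSpec.TC`, `trueRec`, `trueY1`, `trueE`; `rec_trueY1`, `lastBlock_trueY1`, `Jset_trueY1`,
  `Aset_trueE`, `Hof_trueE`, `merge_true_eq`;
* `height_cfg₀_zero_le`, `height_true_le`, `maxH_true_le`, `hi_true_le`, `lo_true_le`,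
  `smallAll_true` (the honest `lo`, `hi` are within the size budget `|x| + (N + 1) b + 1`);
* `arithAll_true`, `branchOK_true`, `lightInit_true`, **`allChecks_true`**, **`accepts_true`**;
* **`complete_of_sizes`**: the size bounds on `encY1 (trueY1 …)` and `encY3 (trueE … j)` and the
  accepting counter at time `N b` give `QSigma 4 c |x| Vlang x`.

No named fact is introduced (definitions with bodies and theorems only).

## References

* W. J. Paul, N. Pippenger, E. Szemerédi, W. T. Trotter, *On determinism versus non-determinism
  and related problems*, FOCS 1983, 429–438, §3 [PaulEtAl1983].
-/

namespace Literature.Computability.Complexity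

open Turing Function _root_.Computability TM2Blocks

set_option linter.constructorNameAsVariable false

namespace TM2Blocks

/-- Field-wise equality of block claims. [folklore] -/
theorem BlockClaim.ext' {tm : FinTM2} {C C' : BlockClaim tm} (h1 : C.l = C'.l) (h2 : C.var = C'.var)
    (h3 : C.ht = C'.ht) (h4 : C.mn = C'.mn) (h5 : C.mx = C'.mx) (h6 : C.frag = C'.frag)
    (h7 : C.efrag = C'.efrag) : C = C' := by
  cases C; cases C'; simp only at h1 h2 h3 h4 h5 h6 h7; subst h1 h2 h3 h4 h5 h6 h7; rfl

/-- Members of a branch set are at most the branch. [folklore] -/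
theorem le_of_mem_branchSet {tm : FinTM2} {c₀ : tm.Cfg} {b : ℕ} {J : Finset ℕ} {j u : ℕ}
    (hu : u ∈ branchSet c₀ b J j) : u ≤ j := by
  simp only [branchSet, Finset.mem_filter, Finset.mem_range] at hu
  omega

end TM2Blocks

namespace PPSTSpec

variable {K : ℕ} (P : AProg Bool (Fin K)) (hP : 0 < P.length) (inp out : Fin K) (acc : ℕ)

/-! ### The honest data -/

/-- The true claims of the packaged machine on input `x`. [folklore] -/
noncomputable def TC (x : List Bool) (b v : ℕ) : BlockClaim (FlatN.tmN P hP inp out) :=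
  trueClaims (FlatN.tmN P hP inp out) (cfg₀ P hP inp out x) b v

/-- **The honest record of block `v`**: true counter, heights, extreme heights, arithmetic
witnesses, the `J` bit, heavy data on `J` only. [cite: PaulEtAl1983, §3] -/
noncomputable def trueRec (x : List Bool) (b : ℕ) (J : Finset ℕ) (v : ℕ) : Rec K :=
  { pc := (P.step^[v * b] ⟨0, AStore.single inp x⟩).pc
    ht := (TC P hP inp out x b v).ht
    mn := (TC P hP inp out x b v).mn
    mx := (TC P hP inp out x b v).mx
    lo := fun k => lo (FlatN.tmN P hP inp out) (cfg₀ P hP inp out x) b k v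
    hi := fun k => hi (FlatN.tmN P hP inp out) (cfg₀ P hP inp out x) b k v
    cut := fun k => lo (FlatN.tmN P hP inp out) (cfg₀ P hP inp out x) b k v * blockβ (FlatN.tmN P hP inp out) b
    hib := fun k => (hi (FlatN.tmN P hP inp out) (cfg₀ P hP inp out x) b k v + 1) * blockβ (FlatN.tmN P hP inp out) b
    jbit := decide (v ∈ J)
    frag := fun k => if v ∈ J then (TC P hP inp out x b v).frag k else []
    efrag := fun k => if v ∈ J then (TC P hP inp out x b v).efrag k else [] }

/-- **The honest first string.** [folklore] -/
noncomputable def trueY1 (x : List Bool) (b N : ℕ) (J : Finset ℕ) : Y1 K :=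
  ⟨b, (List.range (N + 1)).map (trueRec P hP inp out x b J)⟩

/-- **The honest entry order**: the branch first, then the rest of the branch set, increasing.
[folklore] -/
noncomputable def trueL (x : List Bool) (b : ℕ) (J : Finset ℕ) (j : ℕ) : List ℕ :=
  j :: (((branchSet (cfg₀ P hP inp out x) b J j).erase j).sort (· ≤ ·))

/-- The true last toucher of the height block `lo_u k + off` before `u`, coded (`0`: none,
`p + 1`: block `p`). [folklore] -/
noncomputable def trueLt (x : List Bool) (b u : ℕ) (k : Fin K) (off : Bool) : ℕ :=
  match lastToucher (lo (FlatN.tmN P hP inp out) (cfg₀ P hP inp out x) b k)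
      (hi (FlatN.tmN P hP inp out) (cfg₀ P hP inp out x) b k) u
      (lo (FlatN.tmN P hP inp out) (cfg₀ P hP inp out x) b k u + off.toNat) with
  | none => 0
  | some p => p + 1

/-- The honest pointer: the position of the toucher in the entry order. [folklore] -/
noncomputable def truePtr (x : List Bool) (b : ℕ) (J : Finset ℕ) (j u : ℕ) (k : Fin K) (off : Bool) : ℕ :=
  (trueL P hP inp out x b J j).idxOf (trueLt P hP inp out x b u k off - 1)

/-- **The honest entry of block `u`.** [folklore] -/
noncomputable def trueEnt (x : List Bool) (b : ℕ) (J : Finset ℕ) (j u : ℕ) : Entry K :=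
  ⟨u, (TC P hP inp out x b u).frag, (TC P hP inp out x b u).efrag,
    fun k off => trueLt P hP inp out x b u k off, fun k off => truePtr P hP inp out x b J j u k off⟩

/-- **The honest branch data of branch `j`.** [cite: PaulEtAl1983, §3] -/
noncomputable def trueE (x : List Bool) (b : ℕ) (J : Finset ℕ) (j : ℕ) : Y3 K :=
  (trueL P hP inp out x b J j).map (trueEnt P hP inp out x b J j)

variable (x : List Bool) (b N : ℕ) (J : Finset ℕ)

local notation "𝕋" => FlatN.tmN P hP inp out
local notation "𝕔" => cfg₀ P hP inp out x

/-- The honest block length. [folklore] -/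
@[simp] theorem trueY1_b : (trueY1 P hP inp out x b N J).b = b := rfl

/-- The honest records, read back. [folklore] -/
theorem rec_trueY1 {v : ℕ} (hv : v ≤ N) : rec (trueY1 P hP inp out x b N J) v = trueRec P hP inp out x b J v := by
  unfold rec trueY1
  simp only
  rw [List.getElem?_map, List.getElem?_range (by omega)]
  rfl

/-- The honest last block is `N`. [folklore] -/
@[simp] theorem lastBlock_trueY1 : lastBlock (trueY1 P hP inp out x b N J) = N := by
  simp [lastBlock, trueY1]

/-- The honest records are nonempty. [folklore] -/
theorem trueY1_recs_ne_nil : (trueY1 P hP inp out x b N J).recs ≠ [] := by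
  simp [trueY1]

/-- The honest `J` is `J` (for `J` within the blocks). [folklore] -/
theorem Jset_trueY1 (hJ : J ⊆ Finset.range (N + 1)) : Jset (trueY1 P hP inp out x b N J) = J := by
  ext v
  unfold Jset
  simp only [Finset.mem_filter, Finset.mem_range]
  constructor
  · rintro ⟨hv, hj⟩
    have hv' : v ≤ N := by simp [trueY1] at hv; omega
    rw [rec_trueY1 P hP inp out x b N J hv'] at hj
    simpa [trueRec] using hj
  · intro hv
    have hv' := Finset.mem_range.1 (hJ hv)
    refine ⟨by simpa [trueY1] using hv', ?_⟩
    rw [rec_trueY1 P hP inp out x b N J (by omega)]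
    simpa [trueRec] using hv

/-- The honest entry order lists the branch set. [folklore] -/
theorem mem_trueL {j u : ℕ} : u ∈ trueL P hP inp out x b J j ↔ u ∈ branchSet (cfg₀ P hP inp out x) b J j := by
  unfold trueL
  simp only [List.mem_cons, Finset.mem_sort, Finset.mem_erase]
  constructor
  · rintro (rfl | ⟨-, h⟩)
    · exact mem_branchSet_self _ _ _ _
    · exact h
  · intro h
    by_cases hu : u = j
    · exact Or.inl hu
    · exact Or.inr ⟨hu, h⟩

/-- The honest entry order has no duplicates. [folklore] -/
theorem nodup_trueL (j : ℕ) : (trueL P hP inp out x b J j).Nodup := by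
  unfold trueL
  rw [List.nodup_cons]
  exact ⟨by simp, Finset.sort_nodup _ _⟩

/-- The honest branch data, read back. [folklore] -/
theorem ent_trueE {j e : ℕ} (he : e < (trueL P hP inp out x b J j).length) :
    ent (trueE P hP inp out x b J j) e = trueEnt P hP inp out x b J j ((trueL P hP inp out x b J j)[e]) := by
  unfold ent trueE
  rw [List.getElem?_map, List.getElem?_eq_getElem he]
  rfl

/-- The honest branch data have one entry per block of the order. [folklore] -/
@[simp] theorem length_trueE (j : ℕ) : (trueE P hP inp out x b J j).length = (trueL P hP inp out x b J j).length := by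
  simp [trueE]

/-- The honest pointer finds its block. [folklore] -/
theorem trueL_truePtr {j u p : ℕ} {k : Fin K} {off : Bool} (hlt : trueLt P hP inp out x b u k off = p + 1)
    (hp : p ∈ branchSet (cfg₀ P hP inp out x) b J j) :
    truePtr P hP inp out x b J j u k off < (trueL P hP inp out x b J j).length ∧
      (trueL P hP inp out x b J j)[truePtr P hP inp out x b J j u k off]? = some p := by
  have hmem : p ∈ trueL P hP inp out x b J j := (mem_trueL P hP inp out x b J).2 hp
  unfold truePtr
  rw [hlt, Nat.add_sub_cancel]
  exact ⟨List.idxOf_lt_length_iff.2 hmem, by rw [List.getElem?_eq_getElem (List.idxOf_lt_length_iff.2 hmem), List.getElem_idxOf]⟩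

/-- Light fields and arithmetic of the honest claims (blocks `≤ N`). [folklore] -/
theorem claimOf_trueY1 {v : ℕ} (hv : v ≤ N) :
    (claimOf P hP inp out (trueY1 P hP inp out x b N J) v).l = (TC P hP inp out x b v).l ∧
    (claimOf P hP inp out (trueY1 P hP inp out x b N J) v).var = (TC P hP inp out x b v).var ∧
    (claimOf P hP inp out (trueY1 P hP inp out x b N J) v).ht = (TC P hP inp out x b v).ht ∧
    (claimOf P hP inp out (trueY1 P hP inp out x b N J) v).mn = (TC P hP inp out x b v).mn ∧
    (claimOf P hP inp out (trueY1 P hP inp out x b N J) v).mx = (TC P hP inp out x b v).mx ∧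
    (claimOf P hP inp out (trueY1 P hP inp out x b N J) v).frag =
      (fun k => if v ∈ J then (TC P hP inp out x b v).frag k else []) ∧
    (claimOf P hP inp out (trueY1 P hP inp out x b N J) v).efrag =
      (fun k => if v ∈ J then (TC P hP inp out x b v).efrag k else []) := by
  unfold claimOf
  rw [rec_trueY1 P hP inp out x b N J hv]
  refine ⟨?_, ?_, rfl, rfl, rfl, rfl, rfl⟩
  · show FlatN.lbl P (P.step^[v * b] ⟨0, AStore.single inp x⟩).pc = _
    unfold TC trueClaims
    simp only
    have := FlatN.run_cfgN P hP inp out ⟨0, AStore.single inp x⟩ (v * b)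
    change run (FlatN.tmN P hP inp out) (cfg₀ P hP inp out x) (v * b) = _ at this
    rw [this]; rfl
  · show (none : Option Bool) = _
    unfold TC trueClaims
    simp only
    have := FlatN.run_cfgN P hP inp out ⟨0, AStore.single inp x⟩ (v * b)
    change run (FlatN.tmN P hP inp out) (cfg₀ P hP inp out x) (v * b) = _ at this
    rw [this]; rfl

/-- `loC` of the honest claims. [folklore] -/
theorem loC_trueY1 {v : ℕ} (hv : v ≤ N) (k : Fin K) :
    (claimOf P hP inp out (trueY1 P hP inp out x b N J) v).loC b k =
      lo (FlatN.tmN P hP inp out) (cfg₀ P hP inp out x) b k v := by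
  unfold BlockClaim.loC
  rw [(claimOf_trueY1 P hP inp out x b N J hv).2.2.2.1]
  rfl

/-- `hiC` of the honest claims. [folklore] -/
theorem hiC_trueY1 {v : ℕ} (hv : v ≤ N) (k : Fin K) :
    (claimOf P hP inp out (trueY1 P hP inp out x b N J) v).hiC b k =
      hi (FlatN.tmN P hP inp out) (cfg₀ P hP inp out x) b k v := by
  unfold BlockClaim.hiC
  rw [(claimOf_trueY1 P hP inp out x b N J hv).2.2.2.2.1]
  rfl

/-- On `J` the honest claim is the true claim. [folklore] -/
theorem claimOf_trueY1_of_mem_J {v : ℕ} (hv : v ≤ N) (hvJ : v ∈ J) :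
    claimOf P hP inp out (trueY1 P hP inp out x b N J) v = TC P hP inp out x b v := by
  obtain ⟨h1, h2, h3, h4, h5, h6, h7⟩ := claimOf_trueY1 P hP inp out x b N J hv
  refine BlockClaim.ext' h1 h2 h3 h4 h5 ?_ ?_
  · rw [h6]; funext k; rw [if_pos hvJ]
  · rw [h7]; funext k; rw [if_pos hvJ]

/-- Initial heights are at most `|x|`. [folklore] -/
theorem height_cfg₀_zero_le (k : Fin K) :
    height (FlatN.tmN P hP inp out) (cfg₀ P hP inp out x) k 0 ≤ x.length := by
  show ((cfg₀ P hP inp out x).stk k).length ≤ x.length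
  show (AStore.single inp x k).length ≤ x.length
  unfold AStore.single
  split <;> simp

/-- Heights grow by at most one per step. [folklore] -/
theorem height_true_le (k : Fin K) (t : ℕ) :
    height (FlatN.tmN P hP inp out) (cfg₀ P hP inp out x) k t ≤ x.length + t := by
  have h1 := height_le_of_le (cfg₀ P hP inp out x) k 0 t
  rw [Nat.zero_add] at h1
  have h2 := height_cfg₀_zero_le P hP inp out x k
  have h3 : TM2Comp.machinePushBound (FlatN.tmN P hP inp out) * t ≤ 1 * t :=
    Nat.mul_le_mul_right _ (FlatN.machinePushBound_le P hP inp out)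
  omega

/-- `maxH` of block `v` is at most `|x| + (v + 1) b`. [folklore] -/
theorem maxH_true_le (k : Fin K) (v : ℕ) :
    maxH (FlatN.tmN P hP inp out) (cfg₀ P hP inp out x) b k v ≤ x.length + (v + 1) * b := by
  unfold maxH
  refine Finset.sup'_le _ _ fun d hd => ?_
  simp only [Finset.mem_range] at hd
  have := height_true_le P hP inp out x k (v * b + d)
  rw [Nat.succ_mul]; omega

/-- `β ≥ 1`. [folklore] -/
theorem one_le_blockβ : 1 ≤ blockβ (FlatN.tmN P hP inp out) b := by
  unfold blockβ; omega

/-- `hi ≤ maxH + 1`. [folklore] -/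
theorem hi_true_le (k : Fin K) (v : ℕ) :
    hi (FlatN.tmN P hP inp out) (cfg₀ P hP inp out x) b k v ≤
      maxH (FlatN.tmN P hP inp out) (cfg₀ P hP inp out x) b k v + 1 := by
  unfold hi
  have hP1 := FlatN.machinePushBound_le P hP inp out
  calc (maxH (FlatN.tmN P hP inp out) (cfg₀ P hP inp out x) b k v +
          TM2Comp.machinePushBound (FlatN.tmN P hP inp out)) / blockβ (FlatN.tmN P hP inp out) b ≤
        (maxH (FlatN.tmN P hP inp out) (cfg₀ P hP inp out x) b k v + 1) /
          blockβ (FlatN.tmN P hP inp out) b :=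
        Nat.div_le_div_right (by omega)
    _ ≤ maxH (FlatN.tmN P hP inp out) (cfg₀ P hP inp out x) b k v + 1 := Nat.div_le_self _ _

/-- `lo ≤ maxH`. [folklore] -/
theorem lo_true_le (k : Fin K) (v : ℕ) :
    lo (FlatN.tmN P hP inp out) (cfg₀ P hP inp out x) b k v ≤
      maxH (FlatN.tmN P hP inp out) (cfg₀ P hP inp out x) b k v := by
  have hmin : minH (FlatN.tmN P hP inp out) (cfg₀ P hP inp out x) b k v ≤
      maxH (FlatN.tmN P hP inp out) (cfg₀ P hP inp out x) b k v :=
    (minH_le_height (cfg₀ P hP inp out x) b k v 0 (Nat.zero_le _)).trans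
      (height_le_maxH (cfg₀ P hP inp out x) b k v 0 (Nat.zero_le _))
  unfold lo
  exact (Nat.div_le_self _ _).trans ((Nat.sub_le _ _).trans ((Nat.sub_le _ _).trans hmin))

/-- **The honest records are within the size budget.** [folklore] -/
theorem smallAll_true : SmallAll x (trueY1 P hP inp out x b N J) := by
  intro m hm k
  have hlen : (trueY1 P hP inp out x b N J).recs.length = N + 1 := by simp [trueY1]
  have hmN : m ≤ N := by omega
  rw [hlen, trueY1_b, rec_trueY1 P hP inp out x b N J hmN]
  show lo (FlatN.tmN P hP inp out) (cfg₀ P hP inp out x) b k m ≤ x.length + (N + 1) * b + 1 ∧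
    hi (FlatN.tmN P hP inp out) (cfg₀ P hP inp out x) b k m ≤ x.length + (N + 1) * b + 1
  have h1 := maxH_true_le P hP inp out x b k m
  have h2 := hi_true_le P hP inp out x b k m
  have h3 := lo_true_le P hP inp out x b k m
  have h4 : (m + 1) * b ≤ (N + 1) * b := Nat.mul_le_mul_right _ (by omega)
  constructor <;> omega

/-- The honest arithmetic witnesses are right. [folklore] -/
theorem arithAll_true : ArithAll P hP inp out (trueY1 P hP inp out x b N J) := by
  intro m hm k
  have hmN : m ≤ N := by simp [trueY1] at hm; omega
  simp only [trueY1_b]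
  rw [loC_trueY1 P hP inp out x b N J hmN, hiC_trueY1 P hP inp out x b N J hmN]
  unfold BlockClaim.cutC
  rw [loC_trueY1 P hP inp out x b N J hmN, rec_trueY1 P hP inp out x b N J hmN]
  refine ⟨rfl, rfl, rfl, rfl, ?_⟩
  exact (isWalk_blocks (cfg₀ P hP inp out x) b k (m + 2)).two m

/-- **The verifier reads the true heavy data at the block of an honest entry.** [folklore] -/
theorem locFrag_true {j e : ℕ} (he : e < (trueL P hP inp out x b J j).length)
    (huN : (trueL P hP inp out x b J j)[e] ≤ N) :
    locFrag (trueY1 P hP inp out x b N J) (trueE P hP inp out x b J j) e =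
      (TC P hP inp out x b ((trueL P hP inp out x b J j)[e])).frag ∧
    locEfrag (trueY1 P hP inp out x b N J) (trueE P hP inp out x b J j) e =
      (TC P hP inp out x b ((trueL P hP inp out x b J j)[e])).efrag := by
  constructor
  · funext k
    simp only [locFrag, ent_trueE P hP inp out x b J he, trueEnt]
    rw [rec_trueY1 P hP inp out x b N J huN]
    by_cases hJ : (trueL P hP inp out x b J j)[e] ∈ J <;> simp [trueRec, hJ]
  · funext k
    simp only [locEfrag, ent_trueE P hP inp out x b J he, trueEnt]
    rw [rec_trueY1 P hP inp out x b N J huN]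
    by_cases hJ : (trueL P hP inp out x b J j)[e] ∈ J <;> simp [trueRec, hJ]

/-- The honest initial light data. [folklore] -/
theorem lightInit_true : LightInit (cfg₀ P hP inp out x) (claimOf P hP inp out (trueY1 P hP inp out x b N J)) := by
  obtain ⟨h1, h2, h3, -, -, -, -⟩ := claimOf_trueY1 P hP inp out x b N J (v := 0) (Nat.zero_le _)
  have hL := lightInit_trueClaims (cfg₀ P hP inp out x) b (tm := FlatN.tmN P hP inp out)
  exact ⟨h1.trans hL.1, h2.trans hL.2.1, fun k => (congrFun h3 k).trans (hL.2.2 k)⟩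

/-- **The honest data pass all checks** of every branch `j ≤ N`, when the counter at time `N b`
is `acc`: the arithmetic and the budget (`arithAll_true`, `smallAll_true`), the point checks of
the protocol (true light data everywhere, true heavy data read at the branch set whether from the
records on `J` or from the entries, true last touchers and pointers:
`TM2Blocks.condSim_trueClaims`, `condDep_trueClaims`, `closed_branchSet`,
`lastToucher_eq_some_iff`). [cite: PaulEtAl1983, §3] -/
theorem allChecks_true {j : ℕ} (hj : j ≤ N)
    (hfin : (P.step^[N * b] ⟨0, AStore.single inp x⟩).pc = acc) :
    AllChecks P hP inp out acc x (trueY1 P hP inp out x b N J) j (trueE P hP inp out x b J j) := by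
  set D := trueY1 P hP inp out x b N J with hD
  set E := trueE P hP inp out x b J j with hE
  set L := trueL P hP inp out x b J j with hLdef
  have hLN : ∀ {e} (he : e < L.length), L[e] ≤ N := fun he =>
    (le_of_mem_branchSet ((mem_trueL P hP inp out x b J).1 (List.getElem_mem he))).trans hj
  have hLmem : ∀ {e} (he : e < L.length), L[e] ∈ branchSet 𝕔 b J j := fun he =>
    (mem_trueL P hP inp out x b J).1 (List.getElem_mem he)
  have hentu : ∀ {e} (he : e < L.length), (ent E e).u = L[e] := fun he => by
    rw [hE, ent_trueE P hP inp out x b J he]; rfl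
  have hentlt : ∀ {e} (he : e < L.length), ∀ k off,
      (ent E e).lt k off = trueLt P hP inp out x b L[e] k off := fun he k off => by
    rw [hE, ent_trueE P hP inp out x b J he]; rfl
  have hentptr : ∀ {e} (he : e < L.length), ∀ k off,
      (ent E e).ptr k off = truePtr P hP inp out x b J j L[e] k off := fun he k off => by
    rw [hE, ent_trueE P hP inp out x b J he]; rfl
  have hlenE : E.length = L.length := length_trueE P hP inp out x b J j
  -- fields of the honest records
  have hrec : ∀ {v}, v ≤ N → rec D v = trueRec P hP inp out x b J v :=
    fun hv => rec_trueY1 P hP inp out x b N J hv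
  have hlo : ∀ {v}, v ≤ N → ∀ k, (rec D v).lo k = lo 𝕋 𝕔 b k v := fun hv k => by rw [hrec hv]; rfl
  have hhi : ∀ {v}, v ≤ N → ∀ k, (rec D v).hi k = hi 𝕋 𝕔 b k v := fun hv k => by rw [hrec hv]; rfl
  have hcut : ∀ {v}, v ≤ N → ∀ k, (rec D v).cut k = lo 𝕋 𝕔 b k v * blockβ 𝕋 b := fun hv k => by
    rw [hrec hv]; rfl
  have hjbit : ∀ {v}, v ≤ N → (rec D v).jbit = decide (v ∈ J) := fun hv => by rw [hrec hv]; rfl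
  have hrecs : ∀ {v}, v ≤ N → v < D.recs.length := fun hv => by simp [D, trueY1]; omega
  -- the true last toucher of the block `lo_u k + off`
  have hLT : ∀ u k off, trueLt P hP inp out x b u k off =
      match lastToucher (lo 𝕋 𝕔 b k) (hi 𝕋 𝕔 b k) u (lo 𝕋 𝕔 b k u + off.toNat) with
      | none => 0 | some p => p + 1 := fun u k off => rfl
  -- `Tch` on honest records below `N` is `Touches` for the true `lo`/`hi`
  have hTch : ∀ {m} (_ : m ≤ N) k B, Tch D k m B ↔ Touches (lo 𝕋 𝕔 b k) (hi 𝕋 𝕔 b k) m B := by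
    intro m hm k B; unfold Tch Touches; rw [hlo hm, hhi hm]
  -- the guard `lo + off ≤ hi` on the true numbers
  have hguard : ∀ {u} (_ : u ≤ N) {k : Fin K} {off : Bool}, (rec D u).lo k + off.toNat ≤ (rec D u).hi k →
      lo 𝕋 𝕔 b k u + off.toNat ≤ hi 𝕋 𝕔 b k u := by
    intro u hu k off h; rwa [hlo hu, hhi hu] at h
  intro q
  cases q with
  | arith m =>
    intro hm
    exact ⟨arithAll_true P hP inp out x b N J m hm, smallAll_true P hP inp out x b N J m hm⟩
  | lightInit =>
    show (rec D 0).pc = 0 ∧ ∀ k, (rec D 0).ht k = ((cfg₀ P hP inp out x).stk k).length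
    rw [hrec (Nat.zero_le _)]
    refine ⟨by simp [trueRec], fun k => ?_⟩
    simp [trueRec, TC, trueClaims, TM2Blocks.run]
  | final =>
    show Final acc D
    unfold Final
    rw [lastBlock_trueY1, hrec le_rfl]
    exact hfin
  | jInA => exact ⟨_, _, rfl, rfl⟩
  | wf e =>
    intro he
    rw [hlenE] at he
    rw [hentu he, lastBlock_trueY1]
    exact hLN he
  | distinct e e' =>
    intro hee' he'
    rw [hlenE] at he'
    have he : e < L.length := by omega
    rw [hentu he, hentu he']
    intro heq
    exact absurd ((nodup_trueL P hP inp out x b J j).getElem_inj_iff.1 heq) (by omega)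
  | sim e =>
    intro he huN
    rw [hlenE] at he
    rw [hentu he, lastBlock_trueY1] at huN
    rw [hentu he]
    refine ⟨⟨arithAll_true P hP inp out x b N J _ (hrecs huN.le),
      smallAll_true P hP inp out x b N J _ (hrecs huN.le)⟩, ?_⟩
    -- the local family is the true family at `u`, the true light data at `u + 1`
    have hloc := locFrag_true P hP inp out x b N J he (hLN he)
    have h1 : locFam P hP inp out D E e L[e] = TC P hP inp out x b L[e] := by
      unfold locFam
      rw [hentu he, if_pos rfl]
      obtain ⟨a1, a2, a3, a4, a5, -, -⟩ := claimOf_trueY1 P hP inp out x b N J (v := L[e]) (by omega)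
      exact BlockClaim.ext' a1 a2 a3 a4 a5 hloc.1 hloc.2
    have h2 : locFam P hP inp out D E e (L[e] + 1) = claimOf P hP inp out D (L[e] + 1) := by
      unfold locFam; rw [hentu he, if_neg (by omega)]
    obtain ⟨b1, b2, b3, -, -, -, -⟩ := claimOf_trueY1 P hP inp out x b N J (v := L[e] + 1) (by omega)
    rw [trueY1_b, condSim_congr (Γ := trueClaims 𝕋 𝕔 b) h1 (by rw [h2, b1]; rfl) (by rw [h2, b2]; rfl)
      (by rw [h2, b3]; rfl)]
    exact condSim_trueClaims 𝕔 b _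
  | init e =>
    intro he hu0 k
    rw [hlenE] at he
    rw [hentu he] at hu0
    have hloc := (locFrag_true P hP inp out x b N J he (hLN he)).1
    rw [hloc, hu0, hcut (Nat.zero_le _)]
    simp [TC, trueClaims, TM2Blocks.run]
  | closed e k off =>
    intro he _ hhi' p hlt _ hjb
    rw [hlenE] at he
    rw [hentu he] at hhi'
    rw [hentlt he] at hlt
    have huN := hLN he
    have hg := hguard huN hhi'
    -- `p` is the true last toucher, outside `J`, hence in the branch set
    have hLT' := hLT L[e] k off
    rw [hlt] at hLT'
    rcases hq : lastToucher (lo 𝕋 𝕔 b k) (hi 𝕋 𝕔 b k) L[e] (lo 𝕋 𝕔 b k L[e] + off.toNat) with _ | p'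
    · rw [hq] at hLT'; simp at hLT'
    · rw [hq] at hLT'
      simp only [Nat.add_right_cancel_iff] at hLT'
      subst hLT'
      have hpu := (lastToucher_spec hq).1
      have hpJ : p ∉ J := by
        rw [hjbit (by omega)] at hjb
        simpa using hjb
      have hpA : p ∈ branchSet 𝕔 b J j :=
        closed_branchSet 𝕔 b J j L[e] (hLmem he) k (lo 𝕋 𝕔 b k L[e] + off.toNat) p
          (by simp) (by simpa using hg) hq hpJ
      obtain ⟨hptr, hget⟩ := trueL_truePtr P hP inp out x b J (u := L[e]) (k := k) (off := off)
        (by rw [hLT, hq]) hpA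
      rw [hentptr he, hlenE]
      refine ⟨hptr, ?_⟩
      rw [hentu hptr]
      exact (List.getElem_eq_iff hptr).2 hget
  | dep e k off =>
    intro he huN hhi'
    rw [hlenE] at he
    rw [hentu he, lastBlock_trueY1] at huN
    rw [hentu he] at hhi'
    rw [hentu he]
    have hg := hguard huN hhi'
    refine ⟨⟨arithAll_true P hP inp out x b N J _ (hrecs huN),
      smallAll_true P hP inp out x b N J _ (hrecs huN)⟩, ?_⟩
    have hBof : Bof D E e k off = lo 𝕋 𝕔 b k L[e] + off.toNat := by unfold Bof; rw [hentu he, hlo huN]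
    have hloc := (locFrag_true P hP inp out x b N J he (hLN he)).1
    -- the true dependency at `B`
    have CD := condDep_trueClaims 𝕔 b L[e] k (lo 𝕋 𝕔 b k L[e] + off.toNat) (by simp) (by simpa using hg)
    simp only [loC_trueClaims, hiC_trueClaims, cutC_trueClaims] at CD
    rw [hentlt he, hLT L[e] k off, hBof, hloc, hcut huN, trueY1_b]
    rcases hq : lastToucher (lo 𝕋 𝕔 b k) (hi 𝕋 𝕔 b k) L[e] (lo 𝕋 𝕔 b k L[e] + off.toNat) with _ | p
    · have hq' : lastToucher (fun m => lo 𝕋 𝕔 b k m) (fun m => hi 𝕋 𝕔 b k m) L[e]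
          (lo 𝕋 𝕔 b k L[e] + off.toNat) = none := hq
      rw [hq'] at CD
      simpa [TC] using CD
    · have hq' : lastToucher (fun m => lo 𝕋 𝕔 b k m) (fun m => hi 𝕋 𝕔 b k m) L[e]
          (lo 𝕋 𝕔 b k L[e] + off.toNat) = some p := hq
      rw [hq'] at CD
      simp only
      obtain ⟨hpu, htch, -⟩ := lastToucher_spec hq
      have hpN : p ≤ N := by omega
      refine ⟨hpu, (hTch hpN k _).2 htch, ⟨arithAll_true P hP inp out x b N J _ (hrecs hpN),
        smallAll_true P hP inp out x b N J _ (hrecs hpN)⟩, ?_⟩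
      -- the verifier reads the true end contents of `p`
      have htE : tEfrag D E e k off p = (TC P hP inp out x b p).efrag k := by
        unfold tEfrag
        rw [hjbit hpN]
        by_cases hpJ : p ∈ J
        · rw [if_pos (by simpa using hpJ), hrec hpN]
          simp [trueRec, hpJ]
        · rw [if_neg (by simpa using hpJ)]
          have hpA : p ∈ branchSet 𝕔 b J j :=
            closed_branchSet 𝕔 b J j L[e] (hLmem he) k (lo 𝕋 𝕔 b k L[e] + off.toNat) p (by simp)
              (by simpa using hg) hq hpJ
          obtain ⟨hptr, hget⟩ := trueL_truePtr P hP inp out x b J (u := L[e]) (k := k) (off := off)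
            (by rw [hLT, hq]) hpA
          rw [hentptr he, hE, ent_trueE P hP inp out x b J hptr]
          simp only [trueEnt]
          rw [(List.getElem_eq_iff hptr).2 hget]
      rw [hcut hpN, htE]
      simpa [TC] using CD
  | notouch e k off m =>
    intro he _ hhi' hmu hltm
    rw [hlenE] at he
    rw [hentu he] at hhi' hmu
    rw [hentlt he, hLT] at hltm
    have huN := hLN he
    have hBof : Bof D E e k off = lo 𝕋 𝕔 b k L[e] + off.toNat := by unfold Bof; rw [hentu he, hlo huN]
    rw [hBof, hTch (by omega)]
    rcases hq : lastToucher (lo 𝕋 𝕔 b k) (hi 𝕋 𝕔 b k) L[e] (lo 𝕋 𝕔 b k L[e] + off.toNat) with _ | p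
    · exact lastToucher_eq_none_iff.1 hq m hmu
    · rw [hq] at hltm
      exact (lastToucher_spec hq).2.2 m (by simpa using hltm) hmu

/-- **The honest strings are accepted**, for every `y₂` and `y₄`. [cite: PaulEtAl1983, §3] -/
theorem accepts_true
    (hfin : (P.step^[N * b] ⟨0, AStore.single inp x⟩).pc = acc) (y₂ y₄ : List Bool) :
    Accepts P hP inp out acc x (encY1 (trueY1 P hP inp out x b N J)) y₂
      (if (decJ y₂).getD 0 ≤ N then encY3 (trueE P hP inp out x b J ((decJ y₂).getD 0)) else []) y₄ := by
  unfold Accepts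
  rw [decY1_encY1 _ (trueY1_recs_ne_nil P hP inp out x b N J)]
  rcases hJ2 : decJ y₂ with _ | j
  · simp
  · simp only [Option.getD_some]
    by_cases hj : j ≤ N
    · rw [if_pos hj, decY3_encY3]
      rcases hq : decQ K y₄ with _ | q
      · rw [ladder_some_some_some_none]
        exact fun _ => trivial
      · rw [ladder_some_some_some_some]
        exact fun _ => allChecks_true P hP inp out acc x b N J hj hfin q
    · rw [if_neg hj]
      rcases hE : decY3 K [] with _ | E
      · rw [ladder_some_some_none, lastBlock_trueY1]; exact hj
      · rcases hq : decQ K y₄ with _ | q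
        · rw [ladder_some_some_some_none, lastBlock_trueY1]; exact fun h => absurd h hj
        · rw [ladder_some_some_some_some, lastBlock_trueY1]; exact fun h => absurd h hj

/-- **Completeness of the `Σ₄` protocol, modulo sizes.** If the honest first string and every
honest branch string fit the length bound `c |x| + c`, and the flat run sits at `acc` at time
`N b`, then `x` has a witness for `QSigma 4 c |x| Vlang`. [cite: PaulEtAl1983, §3] -/
theorem complete_of_sizes {c : ℕ}
    (hfin : (P.step^[N * b] ⟨0, AStore.single inp x⟩).pc = acc)
    (h1 : (encY1 (trueY1 P hP inp out x b N J)).length ≤ c * x.length + c)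
    (h3 : ∀ j, j ≤ N → (encY3 (trueE P hP inp out x b J j)).length ≤ c * x.length + c) :
    QSigma 4 c x.length (Vlang P hP inp out acc) x := by
  rw [qSigma_four_accepts_iff]
  refine ⟨_, h1, fun y₂ _ => ⟨_, ?_, fun y₄ _ => accepts_true P hP inp out acc x b N J hfin y₂ y₄⟩⟩
  split_ifs with hj
  · exact h3 _ hj
  · simp

end PPSTSpec

end Literature.Computability.Complexity
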